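import Summits.RiemannHypothesis.RiemannHypothesis.Theorems.IntegerScrewDiscreteLandau
import Summits.RiemannHypothesis.RiemannHypothesis.Theorems.IntegerScrewFloorOfRH
import HarnessLib

/-!
# Line `power-sparse-detect` for crux `IntegerScrew.ScrewPolyFloor` (stmt-RiemannHypothesis-15757)

RUNG HARVEST (fwd-harvest RiemannHypothesis/01, from forward seat fwd-rung-RiemannHypothesis-01).

* rung_decl   : `Summit.RiemannHypothesis.RiemannHypothesis.Theses.SparseScrew.PowerSparseDetect`
                (`∀ θ < 1, ∀ C, ∀ A ⊆ ℕ (C,θ)-dense, (∀ a ∈ A, 0 ≤ Ψ(log a)) → RH`, `Ψ = zetaScrew`).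
* seed / floor: route item `IntegerScrew.DiscreteLandau` (stmt-RiemannHypothesis-15758, PROVED:
                `IntegerScrewDiscreteLandau.DiscreteLandau_proof`) = the rung family at `C = 0`
                (`rung_special` below; witness file `Lines/PowerSparseDetect_special.lean`).
* crux        : `ScrewPolyFloor` (⟺ RH, landed: `IntegerScrew.screwPolyFloor_iff_riemannHypothesis`;
                `ScrewPolyFloor ↔ RH ∧ FloorOfRH` with `floorOfRH_proof` landed).

HOW THE RUNG BEARS ON THE CRUX.  The deciding theorem `closes (hF : ScrewPolyFloor) (hL : DiscreteLandau)`
consumes the crux only through RH, and RH enters the route through the DIAGONAL `Ψ(log m) ≥ 0 ∀ m ≥ 1`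
(`screwDiagonalPositivity_iff_riemannHypothesis`).  The rung thins that RH-half input from "positivity at
EVERY integer node" to "positivity along ONE polynomially sparse set of nodes" (`stub_sparseDiagonal`:
some `θ < 1`, `C`, and a `(C,θ)`-dense `A ⊆ ℕ` with `Ψ(log a) ≥ 0` on `A`): modulo the rung,
`stub_sparseDiagonal ⟺ RH` (`sparseDiagonal_iff_rh` below — RH ⇒ it with `A = ℕ≥1` by Suzuki Thm 1.7;
it ⇒ RH by the rung), so the line is HONESTLY LABELLED: its RH content sits in `stub_sparseDiagonal`
(not claimed provable short of RH, exactly like `stub_targetPSD` of line `weil-comb-floor`); its RH-FREE,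
provable-now content is the rung = stubs 1–3, whose composition `PowerSparseDetect_of` is kernel-checked here.

THE LEVER (new relative to the floor).  `DiscreteLandau_proof` interpolates Ψ between consecutive nodes
(`nodeSlack`, additive constant) and runs Landau ONCE; that needs EVERY node.  The rung instead runs Landau
CONTRAPOSITIVELY and QUANTITATIVELY: an off-line zero with abscissa `> 1/2 + η` forces `Ψ(t) < -K e^{ηt}`
somewhere beyond any `T` (`stub_omegaDepth`); the zero-free half-plane `Re s > Θ` (Θ = sup abscissa) bounds
the one-sided RISE `Ψ(t) - Ψ(t₀) ≤ B e^{(Θ-1/2+κ)t}(t - t₀)` (`stub_riseBound`, Ingham Thm 30 / MV 13.1 with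
Θ for 1/2); hence a deep negative value PERSISTS on a window of length `e^{-δ t₀}`, and every `(C,θ)`-dense
set of integers, `θ < 1`, has a node `log a` in every such late window (`stub_denseHits`).  The same Θ sits on
both sides (depth `e^{(Θ-1/2-δ')t}` vs rise `e^{(Θ-1/2+δ/4)t}`), so no case split on Θ.

Disproof used (Cruxes/ScrewPolyFloor/Disproof.lean + landed Negative lemmas): honours §1'
`rh_of_diag_bddBelow` / the sampling remark (any proof must use the sign of Ψ at the nodes — stub 4 is exactly
a node-sign hypothesis, now on a sparse set); consistent with `Negative.ScrewPolyFloorDiagonalInfimum`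
(`exists_zetaScrew_log_lt_neg_of_not_RH`: ¬RH ⇒ Ψ∘log unbounded below on ℕ — the rung upgrades "some node"
to "a node in every (C,θ)-dense set", see `exists_neg_on_dense_of_not_RH`; `zetaScrew_log_not_uniformly_positive`:
no uniform margin is asserted anywhere — stub 4 asks `≥ 0`, not `≥ c`).  No stub is an instance of a landed
Negative lemma; no refuted strengthening (ScrewPolyFloorExponent `A ≥ 1`, IndexFromOne, SignOfC) is touched.

Stubs (4): `stub_omegaDepth` (M) · `stub_riseBound` (L, hardest RH-free) · `stub_denseHits` (S–M) ·
`stub_sparseDiagonal` (RH-equivalent modulo the rung; BY DESIGN, labelled).  Recommended order for provers: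
denseHits → omegaDepth → riseBound; when the three land, `rung : PowerSparseDetect` is a theorem — land it under
`Theorems/` with `--supports stmt-RiemannHypothesis-15757` (it also sharpens the closed item stmt-15758).
-/

set_option linter.dupNamespace false

/-! ## The rung family (verbatim copy of the forward seat's Sketch.lean; rung_decl lives here) -/

namespace Summit.RiemannHypothesis.RiemannHypothesis.Theses.SparseScrew

def SparseDetect (A : Set ℕ) : Prop :=
  (∀ m ∈ A, 0 ≤ Literature.NumberTheory.LFunctions.zetaScrew (Real.log m)) → RiemannHypothesis

def Rung (C θ : ℝ) : Prop :=
  ∀ A : Set ℕ, (∀ m : ℕ, 1 ≤ m → ∃ a ∈ A, m ≤ a ∧ (a : ℝ) ≤ m + C * (m : ℝ) ^ θ) → SparseDetect A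

def SqrtSparseDetect : Prop :=
  ∀ C : ℝ, Rung C (1 / 2)

def PowerSparseDetect : Prop :=
  ∀ θ : ℝ, θ < 1 → ∀ C : ℝ, Rung C θ

def SubexpSlackDetect : Prop :=
  (∀ ε : ℝ, 0 < ε → ∃ K : ℝ, ∀ m : ℕ, 1 ≤ m →
      -K * (m : ℝ) ^ ε ≤ Literature.NumberTheory.LFunctions.zetaScrew (Real.log m)) → RiemannHypothesis

end Summit.RiemannHypothesis.RiemannHypothesis.Theses.SparseScrew

noncomputable section

namespace Summit.RiemannHypothesis.RiemannHypothesis.Cruxes.ScrewPolyFloor.PowerSparseDetect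

open Literature.NumberTheory.LFunctions
open Summit.RiemannHypothesis.RiemannHypothesis.Theses.SparseScrew

/-! ## Stub statements (`Sig.stub_*`; the registered stubs below restate them verbatim, self-contained) -/

namespace Sig

/-- S1 Ω-depth with power slack (Landau, contrapositive, quantitative). -/
def stub_omegaDepth : Prop :=
  ∀ η : ℝ, 0 ≤ η → (∃ ρ : ℂ, riemannZeta ρ = 0 ∧ 1 / 2 + η < ρ.re ∧ ρ.re < 1) →
    ∀ K T : ℝ, ∃ t : ℝ, T ≤ t ∧ 0 ≤ t ∧ zetaScrew t < -K * Real.exp (η * t)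

/-- S2 one-sided Lipschitz rise bound from the zero-free half-plane `Re s > Θ`. -/
def stub_riseBound : Prop :=
  ∀ Θ : ℝ, 1 / 2 < Θ → (∀ ρ : ℂ, riemannZeta ρ = 0 → 1 / 2 < ρ.re → ρ.re < 1 → ρ.re ≤ Θ) →
    ∀ κ : ℝ, 0 < κ → ∃ B : ℝ, 0 ≤ B ∧ ∀ t₀ t : ℝ, 1 ≤ t₀ → t₀ ≤ t →
      zetaScrew t - zetaScrew t₀ ≤ B * Real.exp ((Θ - 1 / 2 + κ) * t) * (t - t₀)

/-- S3 dense integer sets hit every late short window in log scale. -/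
def stub_denseHits : Prop :=
  ∀ θ C : ℝ, θ < 1 → ∀ A : Set ℕ,
    (∀ m : ℕ, 1 ≤ m → ∃ a ∈ A, m ≤ a ∧ (a : ℝ) ≤ m + C * (m : ℝ) ^ θ) →
    ∃ δ : ℝ, 0 < δ ∧ δ ≤ 1 ∧ ∃ T : ℝ, 0 ≤ T ∧ ∀ t₀ L : ℝ, T ≤ t₀ → Real.exp (-(δ * t₀)) ≤ L →
      ∃ a ∈ A, 1 ≤ a ∧ t₀ ≤ Real.log a ∧ Real.log a ≤ t₀ + L

/-- S4 SPARSE DIAGONAL POSITIVITY (the RH half of the crux, thinned by the rung): Ψ∘log is `≥ 0` along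
SOME polynomially dense set of integers. RH-equivalent modulo S1–S3 (`sparseDiagonal_iff_rh`). -/
def stub_sparseDiagonal : Prop :=
  ∃ θ : ℝ, θ < 1 ∧ ∃ C : ℝ, ∃ A : Set ℕ,
    (∀ m : ℕ, 1 ≤ m → ∃ a ∈ A, m ≤ a ∧ (a : ℝ) ≤ m + C * (m : ℝ) ^ θ) ∧
    ∀ a ∈ A, 0 ≤ zetaScrew (Real.log a)

end Sig

/-! ## Registered stubs -/

/-- STUB S1 — Ω-DEPTH (Landau with power slack, contrapositive and quantitative; the floor's
`robustLandau` generalised from the constant slack `K` to `K e^{ηt}`; for `ψ` this is the tree's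
`PsiOscillation.false_of_eventually_le` = MV Thm 15.3). A zero of `ζ` with real part `> 1/2 + η`
forces `Ψ(t) < -K e^{ηt}` at some `t ≥ T`, for every `K` and `T`. Size M (template in tree). RH-free. -/
theorem stub_omegaDepth :
    ∀ η : ℝ, 0 ≤ η → (∃ ρ : ℂ, riemannZeta ρ = 0 ∧ 1 / 2 + η < ρ.re ∧ ρ.re < 1) →
      ∀ K T : ℝ, ∃ t : ℝ, T ≤ t ∧ 0 ≤ t ∧ zetaScrew t < -K * Real.exp (η * t) := by
  sorry

/-- STUB S2 — ONE-SIDED LIPSCHITZ RISE BOUND from a zero-free half-plane (Ingham 1932 Thm 30 /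
MV Thm 13.1 with `Θ` in place of `1/2` — tree template `VonKochTheorem.lean` — then Abel summation
`S(x) = Σ_{n≤x} Λ(n) n^{-1/2} = 2√x - 1 + O(x^{Θ-1/2} log² x)` and the a.e. derivative
`Ψ' = 2(e^{t/2} - e^{-t/2}) - S(e^t) - c₀/2 + O(1)`). If every zero of `ζ` in the open critical
strip has real part `≤ Θ` (`1/2 < Θ`), then for every `κ > 0`:
`Ψ(t) - Ψ(t₀) ≤ B e^{(Θ - 1/2 + κ) t} (t - t₀)` for `1 ≤ t₀ ≤ t`. Size L (hardest RH-free stub). -/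
theorem stub_riseBound :
    ∀ Θ : ℝ, 1 / 2 < Θ → (∀ ρ : ℂ, riemannZeta ρ = 0 → 1 / 2 < ρ.re → ρ.re < 1 → ρ.re ≤ Θ) →
      ∀ κ : ℝ, 0 < κ → ∃ B : ℝ, 0 ≤ B ∧ ∀ t₀ t : ℝ, 1 ≤ t₀ → t₀ ≤ t →
        zetaScrew t - zetaScrew t₀ ≤ B * Real.exp ((Θ - 1 / 2 + κ) * t) * (t - t₀) := by
  sorry

/-- STUB S3 — DENSE SETS HIT LATE SHORT WINDOWS (elementary real analysis: `⌈e^{t₀}⌉`, `log`,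
`rpow`). A `(C, θ)`-dense set of positive integers, `θ < 1`, has an element whose logarithm lies in
every window `[t₀, t₀ + L]` with `L ≥ e^{-δ t₀}` (e.g. `δ = min(1/2, (1-θ)/2)`), once `t₀ ≥ T(C, θ)`;
for `C < 0` the density hypothesis is contradictory at `m = 1`, so the statement is vacuous there.
Size S–M. RH-free. -/
theorem stub_denseHits :
    ∀ θ C : ℝ, θ < 1 → ∀ A : Set ℕ,
      (∀ m : ℕ, 1 ≤ m → ∃ a ∈ A, m ≤ a ∧ (a : ℝ) ≤ m + C * (m : ℝ) ^ θ) →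
      ∃ δ : ℝ, 0 < δ ∧ δ ≤ 1 ∧ ∃ T : ℝ, 0 ≤ T ∧ ∀ t₀ L : ℝ, T ≤ t₀ → Real.exp (-(δ * t₀)) ≤ L →
        ∃ a ∈ A, 1 ≤ a ∧ t₀ ≤ Real.log a ∧ Real.log a ≤ t₀ + L := by
  sorry

/-- STUB S4 — SPARSE DIAGONAL POSITIVITY (RH-strength BY DESIGN; the thinned RH half of the crux;
not claimed provable short of RH — `sparseDiagonal_iff_rh`): for some `θ < 1`, `C` and some
`(C,θ)`-dense `A ⊆ ℕ`, `Ψ(log a) ≥ 0` for all `a ∈ A`. -/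
theorem stub_sparseDiagonal :
    ∃ θ : ℝ, θ < 1 ∧ ∃ C : ℝ, ∃ A : Set ℕ,
      (∀ m : ℕ, 1 ≤ m → ∃ a ∈ A, m ≤ a ∧ (a : ℝ) ≤ m + C * (m : ℝ) ^ θ) ∧
      ∀ a ∈ A, 0 ≤ zetaScrew (Real.log a) := by
  sorry

/-! ## The rung from S1–S3 (kernel-checked composition) -/

/-- The sup-abscissa bookkeeping: under a zero in the open strip there is `Θ ∈ (1/2, 1]` bounding the
real parts of all strip zeros and approximated from below by real parts of zeros. -/
theorem exists_supAbscissa {s₀ : ℂ} (hs₀ : riemannZeta s₀ = 0) (h1 : 1 / 2 < s₀.re)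
    (h2 : s₀.re < 1) :
    ∃ Θ : ℝ, 1 / 2 < Θ ∧ Θ ≤ 1 ∧
      (∀ ρ : ℂ, riemannZeta ρ = 0 → 1 / 2 < ρ.re → ρ.re < 1 → ρ.re ≤ Θ) ∧
      (∀ y : ℝ, y < Θ → ∃ ρ : ℂ, riemannZeta ρ = 0 ∧ y < ρ.re ∧ 1 / 2 < ρ.re ∧ ρ.re < 1) := by
  set Z : Set ℝ := {x | ∃ s : ℂ, riemannZeta s = 0 ∧ 1 / 2 < s.re ∧ s.re < 1 ∧ s.re = x} with hZ
  have hs₀Z : s₀.re ∈ Z := ⟨s₀, hs₀, h1, h2, rfl⟩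
  have hZne : Z.Nonempty := ⟨_, hs₀Z⟩
  have hub : ∀ x ∈ Z, x ≤ 1 := by
    rintro x ⟨s, -, -, hs1, rfl⟩
    exact hs1.le
  have hZbdd : BddAbove Z := ⟨1, hub⟩
  refine ⟨sSup Z, h1.trans_le (le_csSup hZbdd hs₀Z), csSup_le hZne hub, ?_, ?_⟩
  · intro ρ h h' h''
    exact le_csSup hZbdd ⟨ρ, h, h', h'', rfl⟩
  · intro y hy
    obtain ⟨x, ⟨ρ, hρ, hρ1, hρ2, rfl⟩, hx⟩ := exists_lt_of_lt_csSup hZne hy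
    exact ⟨ρ, hρ, hx, hρ1, hρ2⟩

/-- COMPOSITION (kernel-checked, no sorry): stubs S1–S3 give the rung `PowerSparseDetect`. -/
theorem PowerSparseDetect_of (h1 : Sig.stub_omegaDepth) (h2 : Sig.stub_riseBound)
    (h3 : Sig.stub_denseHits) : PowerSparseDetect := by
  intro θ hθ C A hA hpos
  refine quasiRiemannHypothesis_one_half_iff_holds.1 fun s₀ hs₀ h1₀ h2₀ ↦ ?_
  -- the sup abscissa Θ ∈ (1/2, 1]
  obtain ⟨Θ, hΘhalf, hΘ1, hzle, hsup⟩ := exists_supAbscissa hs₀ h1₀ h2₀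
  -- the hitting scale δ ∈ (0, 1] of the dense set, and the rise bound with κ := δ/4
  obtain ⟨δ, hδ, hδ1, T, hT0, hhit⟩ := h3 θ C hθ A hA
  obtain ⟨B, hB0, hB⟩ := h2 Θ hΘhalf hzle (δ / 4) (by positivity)
  -- δ' := min(δ, Θ - 1/2)/2 and η := Θ - 1/2 - δ' ≥ 0; a zero to the right of 1/2 + η
  obtain ⟨δ', hδ'pos, hδ'leδ, hδ'leΘ⟩ :
      ∃ δ' : ℝ, 0 < δ' ∧ δ' ≤ δ / 2 ∧ δ' ≤ (Θ - 1 / 2) / 2 := by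
    refine ⟨min δ (Θ - 1 / 2) / 2, ?_, ?_, ?_⟩
    · have : 0 < min δ (Θ - 1 / 2) := lt_min hδ (by linarith)
      positivity
    · have := min_le_left δ (Θ - 1 / 2); linarith
    · have := min_le_right δ (Θ - 1 / 2); linarith
  have hη0 : 0 ≤ Θ - 1 / 2 - δ' := by linarith
  have hzero : ∃ ρ : ℂ, riemannZeta ρ = 0 ∧ 1 / 2 + (Θ - 1 / 2 - δ') < ρ.re ∧ ρ.re < 1 := by
    obtain ⟨ρ, hρ, hyρ, -, hρ2⟩ := hsup (Θ - δ') (by linarith)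
    exact ⟨ρ, hρ, by linarith, hρ2⟩
  -- a deep negative value beyond max T 1, with K := B e + 1
  obtain ⟨t₀, hTt₀', ht₀0, hdeep⟩ := h1 (Θ - 1 / 2 - δ') hη0 hzero (B * Real.exp 1 + 1) (max T 1)
  have hTt₀ : T ≤ t₀ := (le_max_left T 1).trans hTt₀'
  have h1t₀ : 1 ≤ t₀ := (le_max_right T 1).trans hTt₀'
  -- it persists on the window [t₀, t₀ + L], L := e^{-δ t₀} ≤ 1
  have hL1 : Real.exp (-(δ * t₀)) ≤ 1 := by
    rw [Real.exp_le_one_iff]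
    nlinarith
  have hkey : Real.exp ((Θ - 1 / 2 + δ / 4) * (t₀ + 1)) * Real.exp (-(δ * t₀)) ≤
      Real.exp 1 * Real.exp ((Θ - 1 / 2 - δ') * t₀) := by
    rw [← Real.exp_add, ← Real.exp_add]
    apply Real.exp_le_exp.2
    have hprod : (δ' - 3 * δ / 4) * t₀ ≤ 0 := mul_nonpos_of_nonpos_of_nonneg (by linarith) ht₀0
    nlinarith
  have hneg : ∀ t : ℝ, t₀ ≤ t → t ≤ t₀ + Real.exp (-(δ * t₀)) → zetaScrew t < 0 := by
    intro t h1t h2t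
    have hrise := hB t₀ t h1t₀ h1t
    have htt : 0 ≤ t - t₀ := by linarith
    have httL : t - t₀ ≤ Real.exp (-(δ * t₀)) := by linarith
    have ht1 : t ≤ t₀ + 1 := by linarith
    have hcoef : 0 ≤ Θ - 1 / 2 + δ / 4 := by linarith
    have hexp1 : Real.exp ((Θ - 1 / 2 + δ / 4) * t) ≤ Real.exp ((Θ - 1 / 2 + δ / 4) * (t₀ + 1)) :=
      Real.exp_le_exp.2 (mul_le_mul_of_nonneg_left ht1 hcoef)
    -- rise ≤ B e^{(Θ-1/2+δ/4)(t₀+1)} e^{-δ t₀} ≤ B e · e^{η t₀}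
    have hr1 : B * Real.exp ((Θ - 1 / 2 + δ / 4) * t) * (t - t₀) ≤
        B * Real.exp ((Θ - 1 / 2 + δ / 4) * (t₀ + 1)) * Real.exp (-(δ * t₀)) := by
      apply mul_le_mul (mul_le_mul_of_nonneg_left hexp1 hB0) httL htt
      exact mul_nonneg hB0 (Real.exp_pos _).le
    have hr2 : B * Real.exp ((Θ - 1 / 2 + δ / 4) * (t₀ + 1)) * Real.exp (-(δ * t₀)) ≤
        B * (Real.exp 1 * Real.exp ((Θ - 1 / 2 - δ') * t₀)) := by
      rw [mul_assoc]
      exact mul_le_mul_of_nonneg_left hkey hB0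
    have hE : 0 < Real.exp ((Θ - 1 / 2 - δ') * t₀) := Real.exp_pos _
    -- Ψ(t) ≤ Ψ(t₀) + rise < -(B e + 1) e^{η t₀} + B e e^{η t₀} = -e^{η t₀} < 0
    nlinarith [hrise, hr1, hr2, hdeep, hE]
  -- but the dense set has a sample point in the window, where Ψ∘log ≥ 0
  obtain ⟨a, haA, -, h1a, h2a⟩ := hhit t₀ (Real.exp (-(δ * t₀))) hTt₀ le_rfl
  exact absurd (hpos a haA) (not_le.2 (hneg (Real.log a) h1a h2a))

/-- THE RUNG modulo its three RH-free stubs (sorries live only in `stub_omegaDepth/riseBound/denseHits`). -/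
theorem rung : PowerSparseDetect :=
  PowerSparseDetect_of stub_omegaDepth stub_riseBound stub_denseHits

/-! ## Ladder position: floor = `C = 0` (seed, PROVED), `θ = 1/2` below, this rung `θ < 1` -/

/-- The floor as a member of the family (witness of F3/BC5: `C = 0` forces `a = m`, then the seed
`DiscreteLandau_proof`). Sorry-free. -/
theorem rung_special (θ : ℝ) : Rung 0 θ := by
  intro A hA hpos
  refine Summit.RiemannHypothesis.RiemannHypothesis.Theorems.IntegerScrewDiscreteLandau.DiscreteLandau_proof
    fun m hm ↦ ?_
  obtain ⟨a, haA, hma, ham⟩ := hA m hm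
  have hle : (a : ℝ) ≤ m := by simpa using ham
  have hma' : a = m := le_antisymm (by exact_mod_cast hle) hma
  exact hma' ▸ hpos a haA

/-- Literally the seed's statement, recovered from the family (sanity; sorry-free). -/
theorem discreteLandau_of_family :
    Summit.RiemannHypothesis.RiemannHypothesis.Theses.IntegerScrew.DiscreteLandau := by
  intro h
  exact rung_special 0 {m | 1 ≤ m} (fun m hm ↦ ⟨m, hm, le_rfl, by simp⟩) (fun m hm ↦ h m hm)

/-- The family is a ladder in `C`: a larger `C` is a stronger rung. Sorry-free. -/
theorem Rung.anti {C C' θ : ℝ} (hCC' : C ≤ C') (h : Rung C' θ) : Rung C θ := by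
  intro A hA
  refine h A fun m hm ↦ ?_
  obtain ⟨a, haA, hma, ham⟩ := hA m hm
  refine ⟨a, haA, hma, ham.trans ?_⟩
  have : 0 ≤ (m : ℝ) ^ θ := Real.rpow_nonneg (Nat.cast_nonneg m) θ
  nlinarith

/-- This rung sits above the `θ = 1/2` rung. Sorry-free. -/
theorem sqrtSparseDetect_of_powerSparseDetect (h : PowerSparseDetect) : SqrtSparseDetect :=
  fun C ↦ h (1 / 2) (by norm_num) C

/-! ## The RH half, thinned: `stub_sparseDiagonal ⟺ RH` modulo the rung (honest labelling) -/

/-- RH ⇒ S4, with `θ = 0`, `C = 0`, `A = ℕ≥1` (Suzuki 2023 Thm 1.7, tree `Suzuki2023_thm17_holds`).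
So S4 is RH-implied (not misstated). Sorry-free. -/
theorem sparseDiagonal_of_rh (hRH : _root_.RiemannHypothesis) : Sig.stub_sparseDiagonal :=
  ⟨0, one_pos, 0, {m | 1 ≤ m}, fun m hm ↦ ⟨m, hm, le_rfl, by simp⟩,
    fun a _ ↦ Suzuki2023_thm17_holds.1.mp hRH (Real.log a)⟩

/-- The rung turns S4 into RH. Sorry-free. -/
theorem rh_of_sparseDiagonal (hP : PowerSparseDetect) (hD : Sig.stub_sparseDiagonal) :
    _root_.RiemannHypothesis := by
  obtain ⟨θ, hθ, C, A, hA, hpos⟩ := hD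
  exact hP θ hθ C A hA hpos

/-- HONESTY LEMMA: modulo the rung, S4 is exactly RH. Sorry-free. -/
theorem sparseDiagonal_iff_rh (hP : PowerSparseDetect) :
    Sig.stub_sparseDiagonal ↔ _root_.RiemannHypothesis :=
  ⟨rh_of_sparseDiagonal hP, sparseDiagonal_of_rh⟩

/-- The rung in Disproof language (cf. `Negative.ScrewPolyFloorDiagonalInfimum.exists_zetaScrew_log_lt_neg_of_not_RH`:
¬RH ⇒ a negative node SOMEWHERE): ¬RH ⇒ a negative node inside EVERY `(C,θ)`-dense set, `θ < 1`. Sorry-free. -/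
theorem exists_neg_on_dense_of_not_RH (hP : PowerSparseDetect) (hRH : ¬ _root_.RiemannHypothesis)
    {θ : ℝ} (hθ : θ < 1) (C : ℝ) (A : Set ℕ)
    (hA : ∀ m : ℕ, 1 ≤ m → ∃ a ∈ A, m ≤ a ∧ (a : ℝ) ≤ m + C * (m : ℝ) ^ θ) :
    ∃ a ∈ A, zetaScrew (Real.log a) < 0 := by
  by_contra hcon
  exact hRH (hP θ hθ C A hA fun a ha ↦ not_lt.1 fun h ↦ hcon ⟨a, ha, h⟩)

/-! ## Conclusion of the crux BY NAME -/

/-- SKELETON THEOREM: the four stubs give the crux `IntegerScrew.ScrewPolyFloor` by name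
(S1–S3 ⇒ rung; rung + S4 ⇒ RH; RH ⇒ floor by the landed `floorOfRH_proof`). No sorry here. -/
theorem ScrewPolyFloor_of (h1 : Sig.stub_omegaDepth) (h2 : Sig.stub_riseBound)
    (h3 : Sig.stub_denseHits) (h4 : Sig.stub_sparseDiagonal) :
    Summit.RiemannHypothesis.RiemannHypothesis.Theses.IntegerScrew.ScrewPolyFloor :=
  Summit.RiemannHypothesis.RiemannHypothesis.Theorems.floorOfRH_proof
    (rh_of_sparseDiagonal (PowerSparseDetect_of h1 h2 h3) h4)

/-- The crux modulo the four stubs. -/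
theorem screwPolyFloor :
    Summit.RiemannHypothesis.RiemannHypothesis.Theses.IntegerScrew.ScrewPolyFloor :=
  ScrewPolyFloor_of stub_omegaDepth stub_riseBound stub_denseHits stub_sparseDiagonal

end Summit.RiemannHypothesis.RiemannHypothesis.Cruxes.ScrewPolyFloor.PowerSparseDetect

end
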